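import Summits.QuantumFields.BalabanUV.T4Continuum.Support.NE9BirthCouplingTwoPoint
import Summits.QuantumFields.BalabanUV.T4Continuum.Support.NE9LocalTwoPoint

/-!
# NE9ScalingDictionary — the scaled ↔ unscaled ONE-BLOCK DICTIONARY `t = s⁻²`, `x = s•y` between the two activity-level
pictures used by the (L)-suppliers of row NE9 (node U3, cell `pub-balaban`, rung (B)+1 on a finite T⁴): road P3's
UNSCALED real-coupling block activity (`T4ComplexDilation.act` / `NE9BirthCouplingTwoPoint.actR`: the coupling `t`
multiplies the action, the cut-off is `t`-free) IS road P1's SCALED FORM (`NE9CouplingTwoPoint.formAct`: an `s`-free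
Gaussian reference measure, a cut-off set moving with the coupling, a dilated exponent), and the insertion supplier (iv)
therefore delivers the coupling two-point clause of supplier (ii) — shell channel included — in t-currency
(unit `b2b-balaban-t4-ne9-formalise-leaf-04`, ROUND-2 crew seat of `t4/T4-NE9-TRIGGER.json` 7f8f59a8ada323d5, condition c4
«the three (L)-suppliers must agree term by term (shell term ↔ part of ⟨Q_Z⟩_t)» and c5 «moduli per unit of t = g⁻²»;
journal CLAIM 2026-08-20 l.5796)

HONEST FRAMING (T4-DAG PAGE 1).  Rung (B)+1 on a FIXED finite torus; NOT infinite volume, NOT the mass gap, NOT Clay.  NE9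
is NOT PRINTED and is NOT PROVED here (spine 0/9 unchanged).  This module is OUR OWN WORK (Summits side): a change of
variables and a chain of elementary identities on the abstract one-block MODEL objects already in the tree; it asserts
NOTHING about Bałaban's functionals.  The manuscripts under audit are named for STRUCTURE only: [Balaban1987RG1] p. 267
(2.10) writes the step in the unscaled fluctuation variables `B′` with the prefactor `1/g_k²` in front of every term of the
fluctuation action, the cut-off (2.9) p. 266 «χ_k = Π χ({|B′(b)| < ε₁})» being `g_k`-free; p. 267 then makes «the scaling
transformation B = g_kB′», after which «the only term with a negative power of g_k is the action evaluated at the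
configuration U_{k+1}» and the quadratic form is of order 0 in `g_k`, the new term being (2.13) p. 268
«E^{(k+1)}(g_k, U_{k+1}) = log ∫ dμ_{C^{(k)}}(B) χ_k exp[P^{(k)}(g_k, U_{k+1}, B) + {…}]», with the small-field condition
read in the scaled variables as «{B : |B| < ε₁g_k^{−1} on Y}» ([Balaban1988RG2Cluster] (1.34) p. 9).  At one-block
model level this is the substitution `x = s•y` below (unscaled `x`, scaled `y`, `s = g_k`, `t = g_k⁻²`).
(ABSOLUTE RULE: nothing printed is used as a hypothesis; every declaration is [folklore].)

WHAT IS PROVED (letters of `T4ComplexDilation`: `blockInt μ f S w = ∫ f·e^{−wS} dμ`, `gaussNorm A = N_A`, `invNorm A = P_A`,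
`act = P_A·blockInt`, `absAct`; of `NE9BirthCouplingTwoPoint`: `realNorm A r = ‖N_A(r)‖⁻¹`, `actR = realNorm·blockInt`,
`birthConst θ n = K(θ,n)`; of `NE9CouplingTwoPoint`: `formAct μ S pre V s = ∫ 1_{S(s)}·pre·exp(V s) dμ`; of `NE9LocalTwoPoint`:
`cutoffLF sb lb B ε₁ s`, thresholds `ε₁/s`).  Data: `X = ι → ℝ` with Lebesgue measure, `quadForm A x = ½·xᵀAx` (`A ≻ 0`), a
non-quadratic rest `P`, a coupling-free cut-off set `K` and density `e^{Φ}`.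
* §1 `quadForm` is 2-homogeneous; `blockInt volume 1 (quadForm A) = gaussNorm A`; the `s`-FREE normalised Gaussian reference
  measure `gaussRef A` (density `ν_A(1)·e^{−quadForm A}`).
* §2 on the positive real axis `P_A(t) = ν_A(t)` and `act A μ f S t = actR A μ f S t` (the two lineages' normalisations agree).
* §3 CHANGE OF VARIABLES `x = s•y`, `t = s⁻²` (`s > 0`): `blockInt volume F S w = sⁿ·∫ F(s•y)·e^{−w·S(s•y)} dy`,
  `ν_A(s⁻²)·sⁿ = ν_A(1)`; the cut-off MOVES (`smul_preimage_cutoffLF`: for bond variables linear in the field,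
  `(s•·)⁻¹(cutoffLF sb lb B ε₁ r) = cutoffLF sb lb B ε₁ (r·s)` — the printed thresholds `ε₁/g_k`); and **`actR_eq_formAct`** /
  **`act_eq_formAct`**: `actR A volume (1_K·e^{Φ}) (quadForm A + P) (s⁻²) = formAct (gaussRef A) (σ ↦ (σ•·)⁻¹K) 1
  (σ y ↦ Φ(σ•y) − σ⁻²·P(σ•y)) s` — the unscaled activity at coupling `t = s⁻²` IS the scaled form at coupling `s`.
* §4 CLIPPING the action to the block (`K.indicator S`) changes neither `blockInt` nor `actR` nor `absAct` — how the standing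
  hypothesis `|S| ≤ S₀` («bounded on the block») of `T4ComplexDilation` is met by a quadratic action.
* §5 THE JUNCTION (c4/c5): chain rule `∂_s = −2s⁻³·∂_t` for `σ ↦ actR(σ⁻²)` through road P3's `hasDerivAt_actR`
  (normalisation term + INSERTION); t-currency transfer of `couplingTwoPoint_of_insertion` to `s, s′ ∈ ]0, γ]` (`t₀ = γ⁻²`); and
  **`formAct_couplingTwoPoint_of_insertion`**: from supplier (iv)'s printed-TYPE hypothesis ALONE (unscaled absolute-value
  functional `≤ N` on the dilated real range `r ≥ (1−θ)γ⁻²`; action bounded and non-negative ON the block) the SCALED cut-off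
  form obeys `‖formAct s‖ ≤ N ∧ ‖formAct s − formAct s′‖ ≤ (K(θ,n)/γ⁻²)·N·|s⁻² − s′⁻²|` — the activity-level coupling two-point
  clause of supplier (ii) (`hCup` shape of `NE9LastCouplingBridge`, t-currency) WITH its moving-threshold SHELL channel: at
  model level the shell term of the scaled picture is part of the total `t`-derivative = the insertion of the unscaled one
  (road P3's prose, journal l.5326 (D)).
NOT HERE: anything localized (no polymers, no `e^{−κd}`); an `s`-free non-constant PREFACTOR of `formAct` (it has no `t`-free
unscaled preimage unless dilation-invariant — the dictionary keeps the prefactor inside the exponent, the printed form (2.13)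
«χ_k exp[𝐏^{(k)} + {…}]»); Bałaban's objects (skeleton item O-NE9-1).
References (STRUCTURE only): T. Bałaban, CMP **109** (1987) 249–301 [Balaban1987RG1], (2.9)–(2.13) pp. 266–268; CMP **116**
(1988) 1–22 [Balaban1988RG2Cluster], (1.34) p. 9.  Kernel inputs BY NAME: `T4ComplexDilation` (p188799/p189052),
`NE9BirthInsertion` (p207047), `NE9BirthCouplingTwoPoint` (p207364), `NE9CouplingTwoPoint`, `NE9LocalTwoPoint`; Mathlib
`Measure.integral_comp_smul`, `integral_withDensity_eq_integral_smul`, `Complex.ofReal_cpow`, `HasDerivAt.scomp`; modifies nothing.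
-/

noncomputable section

namespace Summit.QuantumFields.BalabanUV.T4Continuum.NE9ScalingDictionary

open MeasureTheory Complex Set Matrix
open scoped NNReal ENNReal
open Literature.MathematicalPhysics.QuantumFieldTheory.Balaban1983to89.T4ComplexDilation
open Summit.QuantumFields.BalabanUV.T4Continuum.NE9BirthInsertion (insertion)
open Summit.QuantumFields.BalabanUV.T4Continuum.NE9BirthCouplingTwoPoint
open Summit.QuantumFields.BalabanUV.T4Continuum.NE9CouplingTwoPoint (formAct)
open Summit.QuantumFields.BalabanUV.T4Continuum.NE9LocalTwoPoint (cutoffLF)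

variable {ι : Type*} [Fintype ι] [DecidableEq ι]

/-! ## §1 The quadratic action, its homogeneity, and the `s`-free Gaussian reference measure -/

/-- The quadratic (free) action density `½·xᵀAx` of the one-block model — the `S` for which `blockInt volume 1 S` is the
Gaussian normalisation `gaussNorm A`. [folklore] -/
def quadForm (A : Matrix ι ι ℝ) (x : ι → ℝ) : ℝ := (1 / 2) * (x ⬝ᵥ (A *ᵥ x))

omit [DecidableEq ι] in
/-- `quadForm` is homogeneous of degree two: `q(s•y) = s²·q(y)`. [folklore] -/
theorem quadForm_smul (A : Matrix ι ι ℝ) (s : ℝ) (y : ι → ℝ) : quadForm A (s • y) = s ^ 2 * quadForm A y := by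
  unfold quadForm
  rw [Matrix.mulVec_smul, dotProduct_smul, smul_dotProduct, smul_eq_mul, smul_eq_mul]
  ring

omit [DecidableEq ι] in
/-- `quadForm A` is continuous (a polynomial in the coordinates). [folklore] -/
theorem continuous_quadForm (A : Matrix ι ι ℝ) : Continuous (quadForm A) := by
  unfold quadForm
  exact continuous_const.mul (Continuous.dotProduct continuous_id (Continuous.matrix_mulVec continuous_const continuous_id))

omit [DecidableEq ι] in
/-- `quadForm A` is measurable. [folklore] -/
theorem measurable_quadForm (A : Matrix ι ι ℝ) : Measurable (quadForm A) := (continuous_quadForm A).measurable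

omit [DecidableEq ι] in
/-- The Gaussian normalisation IS the block integral of the quadratic action with unit density:
`blockInt volume 1 (quadForm A) w = N_A(w)`. [folklore] -/
theorem blockInt_one_quadForm (A : Matrix ι ι ℝ) (w : ℂ) :
    blockInt volume (fun _ => (1 : ℂ)) (quadForm A) w = gaussNorm A w := by
  unfold blockInt gaussNorm quadForm
  refine integral_congr_ae (Filter.Eventually.of_forall fun x => ?_)
  simp only [one_mul]
  congr 1
  push_cast
  ring

/-- The density `ν_A(1)·e^{−quadForm A y}` of the `s`-FREE normalised Gaussian reference measure of the scaled picture
(model of the `g_k`-free measure `dμ_{C^{(k)}}(B)` of [Balaban1987RG1] (2.13) p. 268 — STRUCTURE only). [folklore] -/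
def gaussDensity (A : Matrix ι ι ℝ) (y : ι → ℝ) : ℝ≥0 :=
  ⟨realNorm A 1 * Real.exp (-quadForm A y), mul_nonneg (realNorm_nonneg A 1) (Real.exp_nonneg _)⟩

omit [DecidableEq ι] in
/-- The Gaussian density is measurable. [folklore] -/
theorem measurable_gaussDensity (A : Matrix ι ι ℝ) : Measurable (gaussDensity A) := by
  refine Measurable.subtype_mk ?_
  exact measurable_const.mul (Real.measurable_exp.comp (measurable_quadForm A).neg)

/-- The `s`-free normalised Gaussian reference measure `dμ_A(y) = ν_A(1)·e^{−½yᵀAy} dy` of the scaled picture. [folklore] -/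
def gaussRef (A : Matrix ι ι ℝ) : Measure (ι → ℝ) := volume.withDensity fun y => (gaussDensity A y : ℝ≥0∞)

omit [DecidableEq ι] in
/-- Integration against `gaussRef A` = Lebesgue integration against the density `ν_A(1)·e^{−quadForm A}`. [folklore] -/
theorem integral_gaussRef (A : Matrix ι ι ℝ) (g : (ι → ℝ) → ℂ) :
    ∫ y, g y ∂(gaussRef A) = ∫ y, ((realNorm A 1 * Real.exp (-quadForm A y) : ℝ) : ℂ) * g y := by
  unfold gaussRef
  rw [integral_withDensity_eq_integral_smul (measurable_gaussDensity A)]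
  refine integral_congr_ae (Filter.Eventually.of_forall fun y => ?_)
  simp only [NNReal.smul_def, Complex.real_smul]
  rfl

/-! ## §2 On the positive real axis the two normalisations agree: `P_A(t) = ν_A(t)`, `act = actR` -/

/-- For real `t ≥ 0` the closed-form inverse normalisation is the REAL number `(t/2π)^{n/2}·√(det A)`. [folklore] -/
theorem invNorm_ofReal (A : Matrix ι ι ℝ) {t : ℝ} (ht : 0 ≤ t) :
    invNorm A (t : ℂ) =
      (((t / (2 * Real.pi)) ^ ((Fintype.card ι : ℝ) / 2) * Real.sqrt A.det : ℝ) : ℂ) := by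
  unfold invNorm
  have h2π : (0 : ℝ) ≤ t / (2 * Real.pi) := div_nonneg ht (by positivity)
  have e : (t : ℂ) / (2 * Real.pi) = ((t / (2 * Real.pi) : ℝ) : ℂ) := by push_cast; ring
  rw [e, ← Complex.ofReal_cpow h2π]
  push_cast
  ring

/-- **`P_A(t) = ν_A(t)` for real `t > 0`**: the holomorphic normalisation `invNorm` of `T4ComplexDilation` (P1 lineage)
and the real normalisation `realNorm` of `NE9BirthCouplingTwoPoint` (road P3) coincide on the positive real axis (both are
non-negative reals of modulus `‖N_A(t)‖⁻¹`). [folklore] -/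
theorem invNorm_ofReal_eq_realNorm (A : Matrix ι ι ℝ) (hA : A.PosDef) {t : ℝ} (ht : 0 < t) :
    invNorm A (t : ℂ) = (realNorm A t : ℂ) := by
  set R : ℝ := (t / (2 * Real.pi)) ^ ((Fintype.card ι : ℝ) / 2) * Real.sqrt A.det with hR
  have hR0 : 0 ≤ R := mul_nonneg (Real.rpow_nonneg (div_nonneg ht.le (by positivity)) _) (Real.sqrt_nonneg _)
  have h1 : invNorm A (t : ℂ) = (R : ℂ) := invNorm_ofReal A ht.le
  have hre : 0 < ((t : ℝ) : ℂ).re := by simpa using ht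
  have h2 : ‖invNorm A (t : ℂ)‖ = realNorm A t := norm_invNorm_eq_inv A hA hre
  rw [h1, Complex.norm_real, Real.norm_of_nonneg hR0] at h2
  rw [h1, h2]

/-- **`act = actR` on the positive real axis**: for real `t > 0` the P1-lineage's complex-normalised one-block activity
`act A μ f S t` equals road P3's real-normalised `actR A μ f S t`. [folklore] -/
theorem act_ofReal_eq_actR (A : Matrix ι ι ℝ) (hA : A.PosDef) {X : Type*} [MeasurableSpace X] (μ : Measure X)
    (f : X → ℂ) (S : X → ℝ) {t : ℝ} (ht : 0 < t) : act A μ f S (t : ℂ) = actR A μ f S t := by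
  unfold act actR
  rw [invNorm_ofReal_eq_realNorm A hA ht]

/-! ## §3 The change of variables `x = s•y`, `t = s⁻²` -/

omit [DecidableEq ι] in
/-- Lebesgue change of variables in the block integral: `∫ F·e^{−wS} dx = sⁿ·∫ F(s•y)·e^{−w·S(s•y)} dy` (`s > 0`,
`n = card ι`; Mathlib `Measure.integral_comp_smul`). [folklore] -/
theorem blockInt_volume_eq_smul (F : (ι → ℝ) → ℂ) (S : (ι → ℝ) → ℝ) (w : ℂ) {s : ℝ} (hs : 0 < s) :
    blockInt volume F S w =
      ((s ^ Fintype.card ι : ℝ) : ℂ) * ∫ y : ι → ℝ, F (s • y) * cexp (-(w * S (s • y))) := by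
  haveI : (volume : Measure (ι → ℝ)).IsAddHaarMeasure := isAddHaarMeasure_volume_pi _
  have h : ∫ y : ι → ℝ, F (s • y) * cexp (-(w * S (s • y))) =
      ((s ^ Fintype.card ι)⁻¹ : ℝ) • ∫ x : ι → ℝ, F x * cexp (-(w * S x)) := by
    have h0 := Measure.integral_comp_smul (volume : Measure (ι → ℝ)) (fun x => F x * cexp (-(w * S x))) s
    rwa [Module.finrank_fintype_fun_eq_card, abs_of_pos (inv_pos.2 (pow_pos hs _))] at h0
  unfold blockInt
  rw [h, Complex.real_smul, ← mul_assoc, ← Complex.ofReal_mul, mul_inv_cancel₀ (pow_pos hs _).ne',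
    Complex.ofReal_one, one_mul]

/-- `ν_A(s⁻²)·sⁿ = ν_A(1)`: the dilated real normalisation absorbs exactly the Jacobian of `x = s•y`. [folklore] -/
theorem realNorm_inv_sq_mul_pow (A : Matrix ι ι ℝ) (hA : A.PosDef) {s : ℝ} (hs : 0 < s) :
    realNorm A ((s⁻¹) ^ 2) * s ^ Fintype.card ι = realNorm A 1 := by
  set n := Fintype.card ι
  have ht : 0 < (s⁻¹) ^ 2 := by positivity
  rw [realNorm_eq A hA ht, realNorm_eq A hA one_pos, one_pow, Real.sqrt_one, mul_one, mul_assoc]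
  have e : Real.sqrt (((s⁻¹) ^ 2) ^ n) * s ^ n = 1 := by
    rw [← pow_mul, mul_comm 2 n, pow_mul, Real.sqrt_sq (pow_nonneg (inv_nonneg.2 hs.le) _), inv_pow,
      inv_mul_cancel₀ (pow_pos hs _).ne']
  rw [e, mul_one]

/-- THE CUT-OFF MOVES WITH THE COUPLING: for bond variables LINEAR in the field (`B b (s•ω) = s·B b ω`) and `s > 0`, the
preimage under `ω ↦ s•ω` of the cut-off set with thresholds `ε₁/r` is the cut-off set with thresholds `ε₁/(r·s)`; with
`r = 1` — the `g_k`-free unscaled cut-off «χ_k = Π χ({|B′(b)| < ε₁})» of [Balaban1987RG1] (2.9) p. 266 — this is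
`NE9LocalTwoPoint.cutoffLF … ε₁ s`, the scaled small-field condition «{B : |B| < ε₁g_k^{−1} on Y}» of
[Balaban1988RG2Cluster] (1.34) p. 9 (STRUCTURE only). [folklore] -/
theorem smul_preimage_cutoffLF {Ω : Type*} [SMul ℝ Ω] {Bd : Type*} (sb lb : Finset Bd) (B : Bd → Ω → ℝ) (ε₁ : ℝ)
    {r s : ℝ} (hr : 0 < r) (hs : 0 < s) (hB : ∀ b ω, B b (s • ω) = s * B b ω) :
    (fun ω => s • ω) ⁻¹' cutoffLF sb lb B ε₁ r = cutoffLF sb lb B ε₁ (r * s) := by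
  ext ω
  simp only [Set.mem_preimage, cutoffLF, Set.mem_setOf_eq, hB, abs_mul, abs_of_pos hs]
  have key : ∀ b, (s * |B b ω| < ε₁ / r ↔ |B b ω| < ε₁ / (r * s)) := fun b => by
    rw [lt_div_iff₀ hr, lt_div_iff₀ (mul_pos hr hs)]
    constructor <;> intro h <;> nlinarith
  have key' : ∀ b, (ε₁ / r ≤ s * |B b ω| ↔ ε₁ / (r * s) ≤ |B b ω|) := fun b => by
    rw [div_le_iff₀ hr, div_le_iff₀ (mul_pos hr hs)]
    constructor <;> intro h <;> nlinarith
  simp only [key, key']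

/-- The scaled cut-off family of an unscaled cut-off set `K`: `K_σ = (σ•·)⁻¹K`. [folklore] -/
def scaledCut (K : Set (ι → ℝ)) (σ : ℝ) : Set (ι → ℝ) := (fun y => σ • y) ⁻¹' K

/-- The scaled exponent of unscaled data `(Φ, P)`: `V σ y = Φ(σ•y) − σ⁻²·P(σ•y)` (the density's exponent, DILATED; the
non-quadratic part of the action with its explicit coupling factor `t = σ⁻²` — «a power of g_k times a function of g_kCB»).
[folklore] -/
def scaledExp (Φ : (ι → ℝ) → ℂ) (P : (ι → ℝ) → ℝ) (σ : ℝ) (y : ι → ℝ) : ℂ :=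
  Φ (σ • y) - (((σ⁻¹) ^ 2 : ℝ) : ℂ) * P (σ • y)

omit [Fintype ι] [DecidableEq ι] in
/-- Membership in the scaled cut-off. [folklore] -/
theorem mem_scaledCut (K : Set (ι → ℝ)) (σ : ℝ) (y : ι → ℝ) : y ∈ scaledCut K σ ↔ σ • y ∈ K := Iff.rfl

/-- **THE DICTIONARY (real normalisation)**: for `s > 0`, the UNSCALED activity at coupling `t = s⁻²` — Lebesgue
reference measure, coupling-free cut-off `K` and density `e^{Φ}`, action `quadForm A + P` multiplied by `t` — equals the
SCALED form at coupling `s` — `s`-free Gaussian `gaussRef A`, cut-off `K_s = (s•·)⁻¹K`, prefactor `1`, dilated exponent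
`Φ(s•y) − s⁻²P(s•y)`:  `actR … (s⁻²) = formAct (gaussRef A) (scaledCut K) 1 (scaledExp Φ P) s`. [folklore] -/
theorem actR_eq_formAct (A : Matrix ι ι ℝ) (hA : A.PosDef) (K : Set (ι → ℝ)) (Φ : (ι → ℝ) → ℂ) (P : (ι → ℝ) → ℝ)
    {s : ℝ} (hs : 0 < s) :
    actR A volume (K.indicator fun x => cexp (Φ x)) (fun x => quadForm A x + P x) ((s⁻¹) ^ 2) =
      formAct (gaussRef A) (scaledCut K) (fun _ => 1) (scaledExp Φ P) s := by
  have hsC : (s : ℂ) ≠ 0 := by exact_mod_cast hs.ne'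
  have htsC : ((s : ℂ)⁻¹) ^ 2 * (s : ℂ) ^ 2 = 1 := by field_simp
  unfold actR formAct
  rw [integral_gaussRef, blockInt_volume_eq_smul _ _ _ hs, ← mul_assoc, ← Complex.ofReal_mul,
    realNorm_inv_sq_mul_pow A hA hs, ← integral_const_mul]
  refine integral_congr_ae (Filter.Eventually.of_forall fun y => ?_)
  dsimp only [scaledExp]
  -- pointwise: both sides vanish off `K_s`, and agree on it
  by_cases hy : s • y ∈ K
  · have hy' : y ∈ scaledCut K s := hy
    rw [Set.indicator_of_mem hy, Set.indicator_of_mem hy', one_mul, quadForm_smul]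
    simp only [Complex.ofReal_mul, Complex.ofReal_add, Complex.ofReal_exp, Complex.ofReal_neg, Complex.ofReal_pow,
      Complex.ofReal_inv]
    have H : cexp (Φ (s • y)) * cexp (-((↑s)⁻¹ ^ 2 * ((↑s) ^ 2 * ↑(quadForm A y) + ↑(P (s • y))))) =
        cexp (-↑(quadForm A y)) * cexp (Φ (s • y) - (↑s)⁻¹ ^ 2 * ↑(P (s • y))) := by
      rw [← Complex.exp_add, ← Complex.exp_add]
      congr 1
      linear_combination (-(quadForm A y : ℂ)) * htsC
    rw [H]
    ring
  · have hy' : y ∉ scaledCut K s := hy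
    rw [Set.indicator_of_notMem hy, Set.indicator_of_notMem hy', zero_mul, mul_zero, mul_zero]

/-- **THE DICTIONARY (holomorphic normalisation)**: the same identity for `T4ComplexDilation.act` at the real point
`t = s⁻²`. [folklore] -/
theorem act_eq_formAct (A : Matrix ι ι ℝ) (hA : A.PosDef) (K : Set (ι → ℝ)) (Φ : (ι → ℝ) → ℂ) (P : (ι → ℝ) → ℝ)
    {s : ℝ} (hs : 0 < s) :
    act A volume (K.indicator fun x => cexp (Φ x)) (fun x => quadForm A x + P x) ((((s⁻¹) ^ 2 : ℝ)) : ℂ) =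
      formAct (gaussRef A) (scaledCut K) (fun _ => 1) (scaledExp Φ P) s := by
  rw [act_ofReal_eq_actR A hA _ _ _ (by positivity : (0 : ℝ) < (s⁻¹) ^ 2), actR_eq_formAct A hA K Φ P hs]

/-! ## §4 Clipping the action to the block (meeting `|S| ≤ S₀` of `T4ComplexDilation`) -/

section Clip

variable {X : Type*} [MeasurableSpace X]

/-- With the cut-off inside the density the block integral sees the action only ON the block: clipping it to `K` changes
nothing. [folklore] -/
theorem blockInt_indicator_clip (μ : Measure X) (K : Set X) (g : X → ℂ) (S : X → ℝ) (w : ℂ) :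
    blockInt μ (K.indicator g) (K.indicator S) w = blockInt μ (K.indicator g) S w := by
  unfold blockInt
  refine integral_congr_ae (Filter.Eventually.of_forall fun x => ?_)
  by_cases hx : x ∈ K
  · simp only [Set.indicator_of_mem hx]
  · simp only [Set.indicator_of_notMem hx, zero_mul]

omit [DecidableEq ι] in
/-- Clipping the action does not change the absolute-value functional. [folklore] -/
theorem absAct_indicator_clip (A : Matrix ι ι ℝ) (μ : Measure X) (K : Set X) (g : X → ℂ) (S : X → ℝ) (r : ℝ) :
    absAct A μ (K.indicator g) (K.indicator S) r = absAct A μ (K.indicator g) S r := by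
  unfold absAct
  congr 1
  refine integral_congr_ae (Filter.Eventually.of_forall fun x => ?_)
  by_cases hx : x ∈ K
  · simp only [Set.indicator_of_mem hx]
  · simp only [Set.indicator_of_notMem hx, norm_zero, zero_mul]

omit [DecidableEq ι] in
/-- Clipping the action does not change the real-normalised activity. [folklore] -/
theorem actR_indicator_clip (A : Matrix ι ι ℝ) (μ : Measure X) (K : Set X) (g : X → ℂ) (S : X → ℝ) (r : ℝ) :
    actR A μ (K.indicator g) (K.indicator S) r = actR A μ (K.indicator g) S r := by
  unfold actR
  rw [blockInt_indicator_clip]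

omit [MeasurableSpace X] in
/-- The clipped action is bounded if the action is bounded on the block. [folklore] -/
theorem abs_indicator_le {K : Set X} {S : X → ℝ} {S₀ : ℝ} (hS₀ : ∀ x ∈ K, |S x| ≤ S₀) (h0 : 0 ≤ S₀) (x : X) :
    |K.indicator S x| ≤ S₀ := by
  by_cases hx : x ∈ K
  · rw [Set.indicator_of_mem hx]; exact hS₀ x hx
  · rw [Set.indicator_of_notMem hx, abs_zero]; exact h0

omit [MeasurableSpace X] in
/-- The clipped action is non-negative if the action is non-negative on the block. [folklore] -/
theorem indicator_nonneg_of {K : Set X} {S : X → ℝ} (hS : ∀ x ∈ K, 0 ≤ S x) (x : X) : 0 ≤ K.indicator S x := by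
  by_cases hx : x ∈ K
  · rw [Set.indicator_of_mem hx]; exact hS x hx
  · rw [Set.indicator_of_notMem hx]

end Clip

/-! ## §5 The junction: chain rule, t-currency transfer, and the scaled two-point clause from the insertion supplier -/

/-- The inner map `σ ↦ σ⁻²` of the dictionary has derivative `−2·s⁻³` at `s ≠ 0`. [folklore] -/
theorem hasDerivAt_inv_sq {s : ℝ} (hs : s ≠ 0) :
    HasDerivAt (fun σ : ℝ => (σ⁻¹) ^ 2) (-(2 * (s⁻¹) ^ 3)) s := by
  have h : HasDerivAt (fun σ : ℝ => σ⁻¹ * σ⁻¹) (-(s ^ 2)⁻¹ * s⁻¹ + s⁻¹ * -(s ^ 2)⁻¹) s :=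
    (hasDerivAt_inv hs).mul (hasDerivAt_inv hs)
  have e : (fun σ : ℝ => (σ⁻¹) ^ 2) = fun σ => σ⁻¹ * σ⁻¹ := funext fun σ => pow_two _
  rw [e]
  refine h.congr_deriv ?_
  ring

/-- **CHAIN RULE `∂_s = −2s⁻³·∂_t`**: the scaled activity `σ ↦ actR(σ⁻²)` is differentiable at `s > 0` with derivative
`(−2s⁻³) • actR′(s⁻²)`, `actR′` being road P3's derivative (normalisation term + INSERTION,
`NE9BirthCouplingTwoPoint.hasDerivAt_actR`) — the scaled picture's coupling derivative (which supplier (ii) splits into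
SHELL + dilated tables + exponential size) is one Jacobian times the unscaled insertion derivative. [folklore] -/
theorem hasDerivAt_actR_inv_sq (A : Matrix ι ι ℝ) (hA : A.PosDef) {X : Type*} [MeasurableSpace X] {μ : Measure X}
    {f : X → ℂ} (hf : Integrable f μ) {S : X → ℝ} (hS : Measurable S) {S₀ : ℝ} (hS₀ : ∀ x, |S x| ≤ S₀) {s : ℝ}
    (hs : 0 < s) :
    HasDerivAt (fun σ : ℝ => actR A μ f S ((σ⁻¹) ^ 2))
      ((-(2 * (s⁻¹) ^ 3)) •
        ((((Fintype.card ι : ℝ) / (2 * (s⁻¹) ^ 2) * realNorm A ((s⁻¹) ^ 2) : ℝ) : ℂ) *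
            blockInt μ f S ((((s⁻¹) ^ 2 : ℝ)) : ℂ) +
          (realNorm A ((s⁻¹) ^ 2) : ℂ) * insertion μ f S ((s⁻¹) ^ 2))) s := by
  have ht : 0 < (s⁻¹) ^ 2 := by positivity
  have houter := hasDerivAt_actR A hA hf hS hS₀ ht
  exact houter.scomp s (hasDerivAt_inv_sq hs.ne')

/-- Couplings in `]0, γ]` have `t = s⁻² ≥ t₀ = γ⁻²`. [folklore] -/
theorem inv_sq_ge_of_mem_Ioc {γ s : ℝ} (hs : s ∈ Ioc 0 γ) : (γ⁻¹) ^ 2 ≤ (s⁻¹) ^ 2 :=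
  pow_le_pow_left₀ (inv_nonneg.2 (hs.1.trans_le hs.2).le) (inv_anti₀ hs.1 hs.2) 2

/-- **t-CURRENCY TRANSFER of road P3's coupling two-point clause to scaled couplings**: under the hypotheses of
`NE9BirthCouplingTwoPoint.couplingTwoPoint_of_insertion` with `t₀ = γ⁻²`, for `s, s′ ∈ ]0, γ]` the scaled activity
`G σ = actR(σ⁻²)` satisfies `‖G s‖ ≤ N ∧ ‖G s − G s′‖ ≤ (K(θ,n)/γ⁻²)·N·|s⁻² − s′⁻²|` — moduli PER UNIT OF `t = g⁻²`
(trigger c5), not per unit of `g`. [folklore] -/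
theorem actR_inv_sq_couplingTwoPoint (A : Matrix ι ι ℝ) (hA : A.PosDef) {X : Type*} [MeasurableSpace X]
    {μ : Measure X} {f : X → ℂ} (hf : Integrable f μ) {S : X → ℝ} (hSm : Measurable S) (hS : ∀ x, 0 ≤ S x) {S₀ : ℝ}
    (hS₀ : ∀ x, |S x| ≤ S₀) {θ : ℝ} (hθ : 0 < θ) (hθ1 : θ < 1) {γ : ℝ} (hγ : 0 < γ) {N : ℝ}
    (habs : ∀ r, (1 - θ) * (γ⁻¹) ^ 2 ≤ r → absAct A μ f S r ≤ N) {s s' : ℝ} (hs : s ∈ Ioc 0 γ)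
    (hs' : s' ∈ Ioc 0 γ) :
    ‖actR A μ f S ((s⁻¹) ^ 2)‖ ≤ N ∧
      ‖actR A μ f S ((s⁻¹) ^ 2) - actR A μ f S ((s'⁻¹) ^ 2)‖ ≤
        birthConst θ (Fintype.card ι) / (γ⁻¹) ^ 2 * N * |(s⁻¹) ^ 2 - (s'⁻¹) ^ 2| :=
  couplingTwoPoint_of_insertion A hA hf hSm hS hS₀ hθ hθ1 (by positivity : (0 : ℝ) < (γ⁻¹) ^ 2) habs
    (inv_sq_ge_of_mem_Ioc hs) (inv_sq_ge_of_mem_Ioc hs')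

/-- **THE JUNCTION (trigger c4, one-block model level).**  From the hypothesis of supplier (iv) ALONE — the printed-TYPE
uniform bound `absAct ≤ N` on the dilated real range `r ≥ (1−θ)γ⁻²` for the UNSCALED block (Lebesgue reference measure,
cut-off `K` and density `e^{Φ}` coupling-free, action `quadForm A + P` bounded and non-negative ON THE BLOCK) — the SCALED
cut-off form of supplier (ii) (`formAct` with the `s`-free Gaussian `gaussRef A`, the MOVING cut-off `K_s = (s•·)⁻¹K`,
prefactor `1`, dilated exponent) satisfies, for all couplings `s, s′ ∈ ]0, γ]`,
`‖formAct s‖ ≤ N ∧ ‖formAct s − formAct s′‖ ≤ (K(θ,n)/γ⁻²)·N·|s⁻² − s′⁻²|`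
— the activity-level coupling two-point clause (`hCup` shape, t-currency) INCLUDING the cut-off shell channel: at model
level the three channels of (ii) and the one insertion of (iv) bound the same function of the coupling. [folklore] -/
theorem formAct_couplingTwoPoint_of_insertion (A : Matrix ι ι ℝ) (hA : A.PosDef) {K : Set (ι → ℝ)}
    (hK : MeasurableSet K) {Φ : (ι → ℝ) → ℂ} (hint : Integrable (K.indicator fun x => cexp (Φ x)) volume)
    {P : (ι → ℝ) → ℝ} (hP : Measurable P) {S₀ : ℝ} (hS₀0 : 0 ≤ S₀)
    (hbd : ∀ x ∈ K, |quadForm A x + P x| ≤ S₀) (hpos : ∀ x ∈ K, 0 ≤ quadForm A x + P x)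
    {θ : ℝ} (hθ : 0 < θ) (hθ1 : θ < 1) {γ : ℝ} (hγ : 0 < γ) {N : ℝ}
    (habs : ∀ r, (1 - θ) * (γ⁻¹) ^ 2 ≤ r →
      absAct A volume (K.indicator fun x => cexp (Φ x)) (fun x => quadForm A x + P x) r ≤ N)
    {s s' : ℝ} (hs : s ∈ Ioc 0 γ) (hs' : s' ∈ Ioc 0 γ) :
    ‖formAct (gaussRef A) (scaledCut K) (fun _ => 1) (scaledExp Φ P) s‖ ≤ N ∧
      ‖formAct (gaussRef A) (scaledCut K) (fun _ => 1) (scaledExp Φ P) s -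
          formAct (gaussRef A) (scaledCut K) (fun _ => 1) (scaledExp Φ P) s'‖ ≤
        birthConst θ (Fintype.card ι) / (γ⁻¹) ^ 2 * N * |(s⁻¹) ^ 2 - (s'⁻¹) ^ 2| := by
  -- clip the action to the block: bounded, non-negative, measurable; `actR`/`absAct` unchanged
  have hSm : Measurable fun x => quadForm A x + P x := (measurable_quadForm A).add hP
  have hSKm : Measurable (K.indicator fun x => quadForm A x + P x) := hSm.indicator hK
  have hSK0 : ∀ x, 0 ≤ K.indicator (fun x => quadForm A x + P x) x :=
    indicator_nonneg_of (S := fun x => quadForm A x + P x) hpos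
  have hSKb : ∀ x, |K.indicator (fun x => quadForm A x + P x) x| ≤ S₀ :=
    abs_indicator_le (S := fun x => quadForm A x + P x) hbd hS₀0
  have habs' : ∀ r, (1 - θ) * (γ⁻¹) ^ 2 ≤ r →
      absAct A volume (K.indicator fun x => cexp (Φ x)) (K.indicator fun x => quadForm A x + P x) r ≤ N :=
    fun r hr => by rw [absAct_indicator_clip]; exact habs r hr
  have key := actR_inv_sq_couplingTwoPoint A hA hint hSKm hSK0 hSKb hθ hθ1 hγ habs' hs hs'
  rw [actR_indicator_clip, actR_indicator_clip, actR_eq_formAct A hA K Φ P hs.1,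
    actR_eq_formAct A hA K Φ P hs'.1] at key
  exact key

end Summit.QuantumFields.BalabanUV.T4Continuum.NE9ScalingDictionary

end
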